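import Mathlib
import HarnessLib

/-!
# The multi-proposal (ensemble, i-SIR) flow sampler is EXACT on a general state space: drawing `n` fresh proposals from the flow and
# moving to a member of the pool `{x, y_1, …, y_n}` chosen with probability proportional to its weight satisfies detailed balance
# with respect to `π = w·q`, for every positive measurable weight

HONEST FRAMING: exact (Metropolis-corrected) sampling algorithms for lattice gauge theory;
figures of merit are autocorrelation/cost numbers at stated couplings and volumes; no
continuum-physics claim.

Venture `LatticeQCDFlow` (cell pub-lqcd), topic `Exactness`; FANOUT row 30 (lean-1, GEN-41).  NEW WORK of the cell, general measurable state
space, over Mathlib only (product measures `Measure.pi`, their invariance under coordinate permutations `measurePreserving_piCongrLeft` and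
the split `measurePreserving_piFinSuccAbove`).  The tree's `Literature/Probability/MarkovChains/MultipleTryIndependenceSampler.lean` and
`Scoring/MultiProposal{Peskun,RelaxationTime}.lean` treat the FINITE state space; flows propose on continuous groups, and GPU practice draws
proposals in batches — the batch rule below ("use all `n` proposals, select `∝ w`", Tjelmeland's pool selection ∕ iterated SIR; Barker's rule at
`n = 1`) is the natural multi-proposal correction.  DEF-FREE: the kernel is any Markov kernel `P` satisfying the defining equation
`P(x, B) = ∫ [Σ_{j ≤ n} w(z_j)·1_B(z_j) / Σ_{i ≤ n} w(z_i)]_{z = (x, y_1, …, y_n)} dq^{⊗n}(y)` (hypothesis `hP`; `w > 0` so the denominator is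
positive and finite).

* §1 `lintegral_pi_succ_eq_lintegral_cons` — `∫ G dq^{⊗(n+1)} = ∫∫ G(x ∷ y) dq^{⊗n}(y) dq(x)` (Fubini through `piFinSuccAbove 0`);
  `piCongrLeft_apply_eq`, `sum_weight_piCongrLeft` — coordinate permutations act by `(σ·z)_i = z_{σ⁻¹ i}` and fix the pool weight `Σ_i w(z_i)`.
* §2 `multiProposal_setLIntegral_eq_pool` — `∫_A P(x, B) π(dx) = ∫ 1_A(z_0) w(z_0) Σ_j w(z_j)1_B(z_j)/Σ_i w(z_i) dq^{⊗(n+1)}(z)` (the current state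
  is an `(n+1)`-st independent draw under `π = w·q`); `pool_integrand_eq_sum`; **`pool_term_swap`** — the `j`-th term is symmetric in `(A, B)`:
  transposing coordinates `0` and `j` preserves `q^{⊗(n+1)}` and the pool weight and exchanges the roles of `A` and `B`.
* §3 **`multiProposal_detailedBalance`** — `∫_A P(x, B) π(dx) = ∫_B P(x, A) π(dx)` for all measurable `A`, `B`: THE ENSEMBLE FLOW SAMPLER IS
  REVERSIBLE WITH RESPECT TO `π` FOR EVERY POSITIVE MEASURABLE WEIGHT AND EVERY `n`; `multiProposal_apply_univ` (`P(x, Ω) = 1`);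
  **`multiProposal_invariant`** — `∫ P(x, B) π(dx) = π(B)`: `π` IS INVARIANT.
Reading (gauge files): proposing a batch of `n` gauge configurations from the flow and resampling one of the `n + 1` (batch plus current) with
probability proportional to `e^{−S}/q̃` is an exact update for the Wilson law, whatever the flow — exactness is kept when the accept/reject
step is replaced by pool selection.  NOT CLAIMED: rates (the finite-state Literature file has Yang–Liu's); the multiple-try Metropolis variant;
optimality among selection rules.  No `sorry`, no new definitions, nothing cited as a fact.
-/

noncomputable section

namespace Summit.Ventures.LatticeQCDFlow.Exactness

open MeasureTheory ProbabilityTheory Function Finset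
open scoped ENNReal

variable {Ω : Type*} [MeasurableSpace Ω] {q : Measure Ω} [IsProbabilityMeasure q] {w : Ω → ℝ} {n : ℕ}

/-! ## §1 Product-measure bookkeeping -/

/-- **Fubini through the first coordinate**: `∫ G dq^{⊗(n+1)} = ∫ (∫ G(x ∷ y) dq^{⊗n}(y)) dq(x)` for measurable `G ≥ 0`. [ours, bookkeeping] -/
theorem lintegral_pi_succ_eq_lintegral_cons (q : Measure Ω) [IsProbabilityMeasure q] (n : ℕ) {G : (Fin (n + 1) → Ω) → ℝ≥0∞}
    (hG : Measurable G) :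
    ∫⁻ z, G z ∂(Measure.pi fun _ : Fin (n + 1) => q) = ∫⁻ x, ∫⁻ y, G (Fin.cons x y) ∂(Measure.pi fun _ : Fin n => q) ∂q := by
  set e := MeasurableEquiv.piFinSuccAbove (fun _ : Fin (n + 1) => Ω) 0 with he
  have hmp : MeasurePreserving e.symm (q.prod (Measure.pi fun _ : Fin n => q)) (Measure.pi fun _ : Fin (n + 1) => q) :=
    (measurePreserving_piFinSuccAbove (fun _ : Fin (n + 1) => q) 0).symm _
  have h1 : ∫⁻ a, G (e.symm a) ∂(q.prod (Measure.pi fun _ : Fin n => q)) = ∫⁻ z, G z ∂(Measure.pi fun _ : Fin (n + 1) => q) :=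
    hmp.lintegral_comp hG
  rw [← h1, lintegral_prod (fun a => G (e.symm a)) (hG.comp e.symm.measurable).aemeasurable]
  refine lintegral_congr fun x => lintegral_congr fun y => ?_
  congr 1
  simp [he, MeasurableEquiv.piFinSuccAbove_symm_apply, Fin.consEquiv]

omit [MeasurableSpace Ω] in
/-- A coordinate permutation acts by `(σ·z)_i = z_{σ⁻¹ i}`. [ours, bookkeeping] -/
theorem piCongrLeft_apply_eq [MeasurableSpace Ω] (σ : Equiv.Perm (Fin (n + 1))) (z : Fin (n + 1) → Ω) (i : Fin (n + 1)) :
    (MeasurableEquiv.piCongrLeft (fun _ : Fin (n + 1) => Ω) σ) z i = z (σ.symm i) := by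
  have h := Equiv.piCongrLeft_apply_apply (fun _ : Fin (n + 1) => Ω) σ z (σ.symm i)
  simp only [Equiv.apply_symm_apply] at h
  rw [MeasurableEquiv.coe_piCongrLeft]
  exact h

/-- The pool weight `Σ_i w(z_i)` is invariant under coordinate permutations. [ours, bookkeeping] -/
theorem sum_weight_piCongrLeft (σ : Equiv.Perm (Fin (n + 1))) (z : Fin (n + 1) → Ω) :
    ∑ i, ENNReal.ofReal (w ((MeasurableEquiv.piCongrLeft (fun _ : Fin (n + 1) => Ω) σ) z i)) = ∑ i, ENNReal.ofReal (w (z i)) := by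
  simp_rw [piCongrLeft_apply_eq]
  exact Equiv.sum_comp σ.symm (fun i => ENNReal.ofReal (w (z i)))

omit [MeasurableSpace Ω] in
/-- The pool weight is positive and finite for a positive weight. [ours, bookkeeping] -/
theorem sum_weight_pos_ne_top (hw0 : ∀ y, 0 < w y) (z : Fin (n + 1) → Ω) :
    (∑ i, ENNReal.ofReal (w (z i))) ≠ 0 ∧ (∑ i, ENNReal.ofReal (w (z i))) ≠ ⊤ := by
  refine ⟨fun h => ?_, ENNReal.sum_ne_top.2 fun i _ => ENNReal.ofReal_ne_top⟩
  have h0 := (Finset.sum_eq_zero_iff.1 h) 0 (Finset.mem_univ _)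
  exact absurd h0 (ne_of_gt (ENNReal.ofReal_pos.2 (hw0 _)))

/-- Measurability of the `j`-th pool term `z ↦ w(z_j)·1_B(z_j)/Σ_i w(z_i)` and of its relatives. [ours, bookkeeping] -/
theorem measurable_poolTerm (hw : Measurable w) {B : Set Ω} (hB : MeasurableSet B) (j : Fin (n + 1)) :
    Measurable fun z : Fin (n + 1) → Ω =>
      ENNReal.ofReal (w (z j)) * B.indicator (fun _ => (1 : ℝ≥0∞)) (z j) / ∑ i, ENNReal.ofReal (w (z i)) := by
  refine Measurable.div ?_ (Finset.measurable_sum _ fun i _ => hw.ennreal_ofReal.comp (measurable_pi_apply i))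
  exact (hw.ennreal_ofReal.comp (measurable_pi_apply j)).mul ((measurable_const.indicator hB).comp (measurable_pi_apply j))

/-! ## §2 The pool representation and the transposition symmetry -/

/-- The `j`-th pool integrand with the current state's factors: `H_j^{A,B}(z) = 1_A(z_0)·w(z_0)·(w(z_j)·1_B(z_j)/Σ_i w(z_i))`; measurable.
[ours, bookkeeping] -/
theorem measurable_poolTermFull (hw : Measurable w) {A B : Set Ω} (hA : MeasurableSet A) (hB : MeasurableSet B) (j : Fin (n + 1)) :
    Measurable fun z : Fin (n + 1) → Ω => A.indicator (fun _ => (1 : ℝ≥0∞)) (z 0) * ENNReal.ofReal (w (z 0)) *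
      (ENNReal.ofReal (w (z j)) * B.indicator (fun _ => (1 : ℝ≥0∞)) (z j) / ∑ i, ENNReal.ofReal (w (z i))) :=
  (((measurable_const.indicator hA).comp (measurable_pi_apply 0)).mul (hw.ennreal_ofReal.comp (measurable_pi_apply 0))).mul
    (measurable_poolTerm hw hB j)

/-- **THE TRANSPOSITION SYMMETRY OF THE `j`-TH POOL TERM**: `∫ H_j^{A,B} dq^{⊗(n+1)} = ∫ H_j^{B,A} dq^{⊗(n+1)}` — swapping coordinates `0` and
`j` preserves the product law and the pool weight and exchanges the roles of `A` and `B`. [ours] -/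
theorem pool_term_swap (hw : Measurable w) {A B : Set Ω} (hA : MeasurableSet A) (hB : MeasurableSet B) (j : Fin (n + 1)) :
    ∫⁻ z, A.indicator (fun _ => (1 : ℝ≥0∞)) (z 0) * ENNReal.ofReal (w (z 0)) *
        (ENNReal.ofReal (w (z j)) * B.indicator (fun _ => (1 : ℝ≥0∞)) (z j) / ∑ i, ENNReal.ofReal (w (z i)))
        ∂(Measure.pi fun _ : Fin (n + 1) => q) =
      ∫⁻ z, B.indicator (fun _ => (1 : ℝ≥0∞)) (z 0) * ENNReal.ofReal (w (z 0)) *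
        (ENNReal.ofReal (w (z j)) * A.indicator (fun _ => (1 : ℝ≥0∞)) (z j) / ∑ i, ENNReal.ofReal (w (z i)))
        ∂(Measure.pi fun _ : Fin (n + 1) => q) := by
  set σ : Equiv.Perm (Fin (n + 1)) := Equiv.swap 0 j with hσ
  set e := MeasurableEquiv.piCongrLeft (fun _ : Fin (n + 1) => Ω) σ with he
  have hmp : MeasurePreserving e (Measure.pi fun _ : Fin (n + 1) => q) (Measure.pi fun _ : Fin (n + 1) => q) :=
    measurePreserving_piCongrLeft (fun _ : Fin (n + 1) => q) σ
  -- the `(A, B)` integrand composed with the swap is the `(B, A)` integrand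
  have h0 : ∀ z : Fin (n + 1) → Ω, e z 0 = z j := fun z => by
    rw [he, piCongrLeft_apply_eq, hσ, Equiv.symm_swap, Equiv.swap_apply_left]
  have hj : ∀ z : Fin (n + 1) → Ω, e z j = z 0 := fun z => by
    rw [he, piCongrLeft_apply_eq, hσ, Equiv.symm_swap, Equiv.swap_apply_right]
  have hW : ∀ z : Fin (n + 1) → Ω, ∑ i, ENNReal.ofReal (w (e z i)) = ∑ i, ENNReal.ofReal (w (z i)) := fun z =>
    sum_weight_piCongrLeft σ z
  have hcomp := hmp.lintegral_comp (measurable_poolTermFull hw hA hB j)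
  rw [← hcomp]
  refine lintegral_congr fun z => ?_
  simp only [h0, hj, hW, div_eq_mul_inv]
  ring

/-- The pool integrand splits over the pool members: `1_A(z_0)w(z_0)·(Σ_j t_j)/W = Σ_j 1_A(z_0)w(z_0)·(t_j/W)` (`ℝ≥0∞`). [ours, bookkeeping] -/
theorem pool_integrand_eq_sum (a b W : ℝ≥0∞) (t : Fin (n + 1) → ℝ≥0∞) :
    a * b * ((∑ j, t j) / W) = ∑ j, a * b * (t j / W) := by
  simp only [div_eq_mul_inv, Finset.sum_mul, Finset.mul_sum]

/-- **THE POOL REPRESENTATION**: under `π = w·q` the current state is an `(n+1)`-st independent draw, so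
`∫_A P(x, B) π(dx) = ∫ 1_A(z_0)·w(z_0)·(Σ_j w(z_j)1_B(z_j))/(Σ_i w(z_i)) dq^{⊗(n+1)}(z)`. [ours] -/
theorem multiProposal_setLIntegral_eq_pool (hw : Measurable w) (P : Kernel Ω Ω)
    (hP : ∀ (x : Ω) {B : Set Ω}, MeasurableSet B → P x B = ∫⁻ y, (∑ j, ENNReal.ofReal (w (Fin.cons (α := fun _ : Fin (n + 1) => Ω) x y j)) *
      B.indicator (fun _ => (1 : ℝ≥0∞)) (Fin.cons (α := fun _ : Fin (n + 1) => Ω) x y j)) /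
      (∑ i, ENNReal.ofReal (w (Fin.cons (α := fun _ : Fin (n + 1) => Ω) x y i))) ∂(Measure.pi fun _ : Fin n => q))
    {A B : Set Ω} (hA : MeasurableSet A) (hB : MeasurableSet B) :
    ∫⁻ x in A, P x B ∂(q.withDensity fun x => ENNReal.ofReal (w x)) =
      ∫⁻ z, A.indicator (fun _ => (1 : ℝ≥0∞)) (z 0) * ENNReal.ofReal (w (z 0)) *
        ((∑ j, ENNReal.ofReal (w (z j)) * B.indicator (fun _ => (1 : ℝ≥0∞)) (z j)) / ∑ i, ENNReal.ofReal (w (z i)))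
        ∂(Measure.pi fun _ : Fin (n + 1) => q) := by
  -- measurability of the pool integrand
  have hsel : Measurable fun z : Fin (n + 1) → Ω =>
      (∑ j, ENNReal.ofReal (w (z j)) * B.indicator (fun _ => (1 : ℝ≥0∞)) (z j)) / ∑ i, ENNReal.ofReal (w (z i)) :=
    (Finset.measurable_sum _ fun j _ => (hw.ennreal_ofReal.comp (measurable_pi_apply j)).mul
      ((measurable_const.indicator hB).comp (measurable_pi_apply j))).div
      (Finset.measurable_sum _ fun i _ => hw.ennreal_ofReal.comp (measurable_pi_apply i))
  have hG : Measurable fun z : Fin (n + 1) → Ω => A.indicator (fun _ => (1 : ℝ≥0∞)) (z 0) * ENNReal.ofReal (w (z 0)) *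
      ((∑ j, ENNReal.ofReal (w (z j)) * B.indicator (fun _ => (1 : ℝ≥0∞)) (z j)) / ∑ i, ENNReal.ofReal (w (z i))) :=
    (((measurable_const.indicator hA).comp (measurable_pi_apply 0)).mul (hw.ennreal_ofReal.comp (measurable_pi_apply 0))).mul hsel
  rw [lintegral_pi_succ_eq_lintegral_cons q n hG]
  -- the left side against `q`
  have hK : Measurable fun x => P x B := Kernel.measurable_coe _ hB
  rw [setLIntegral_withDensity_eq_setLIntegral_mul _ hw.ennreal_ofReal hK hA, ← lintegral_indicator hA]
  refine lintegral_congr fun x => ?_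
  simp only [Fin.cons_zero]
  have hc : A.indicator (fun _ => (1 : ℝ≥0∞)) x * ENNReal.ofReal (w x) ≠ ⊤ :=
    ENNReal.mul_ne_top (by by_cases hx : x ∈ A <;> simp [hx]) ENNReal.ofReal_ne_top
  rw [lintegral_const_mul' _ _ hc, ← hP x hB]
  by_cases hx : x ∈ A
  · simp only [Set.indicator_of_mem hx, Pi.mul_apply, one_mul]
  · simp only [Set.indicator_of_notMem hx, zero_mul]

/-! ## §3 Detailed balance and invariance -/

/-- **THE MULTI-PROPOSAL FLOW SAMPLER IS IN DETAILED BALANCE WITH `π = w·q`**: for every positive measurable weight, every `n` and every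
Markov kernel `P` satisfying the pool-selection equation, `∫_A P(x, B) π(dx) = ∫_B P(x, A) π(dx)` for all measurable `A`, `B`. [ours] -/
theorem multiProposal_detailedBalance (hw : Measurable w) (P : Kernel Ω Ω)
    (hP : ∀ (x : Ω) {B : Set Ω}, MeasurableSet B → P x B = ∫⁻ y, (∑ j, ENNReal.ofReal (w (Fin.cons (α := fun _ : Fin (n + 1) => Ω) x y j)) *
      B.indicator (fun _ => (1 : ℝ≥0∞)) (Fin.cons (α := fun _ : Fin (n + 1) => Ω) x y j)) /
      (∑ i, ENNReal.ofReal (w (Fin.cons (α := fun _ : Fin (n + 1) => Ω) x y i))) ∂(Measure.pi fun _ : Fin n => q))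
    {A B : Set Ω} (hA : MeasurableSet A) (hB : MeasurableSet B) :
    ∫⁻ x in A, P x B ∂(q.withDensity fun x => ENNReal.ofReal (w x)) =
      ∫⁻ x in B, P x A ∂(q.withDensity fun x => ENNReal.ofReal (w x)) := by
  rw [multiProposal_setLIntegral_eq_pool hw P hP hA hB, multiProposal_setLIntegral_eq_pool hw P hP hB hA]
  simp_rw [pool_integrand_eq_sum]
  rw [lintegral_finsetSum _ fun j _ => measurable_poolTermFull hw hA hB j,
    lintegral_finsetSum _ fun j _ => measurable_poolTermFull hw hB hA j]
  exact Finset.sum_congr rfl fun j _ => pool_term_swap hw hA hB j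

/-- The pool-selection kernel has total mass one: `P(x, Ω) = 1`. [ours, bookkeeping] -/
theorem multiProposal_apply_univ (hw0 : ∀ y, 0 < w y) (P : Kernel Ω Ω)
    (hP : ∀ (x : Ω) {B : Set Ω}, MeasurableSet B → P x B = ∫⁻ y, (∑ j, ENNReal.ofReal (w (Fin.cons (α := fun _ : Fin (n + 1) => Ω) x y j)) *
      B.indicator (fun _ => (1 : ℝ≥0∞)) (Fin.cons (α := fun _ : Fin (n + 1) => Ω) x y j)) /
      (∑ i, ENNReal.ofReal (w (Fin.cons (α := fun _ : Fin (n + 1) => Ω) x y i))) ∂(Measure.pi fun _ : Fin n => q))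
    (x : Ω) : P x Set.univ = 1 := by
  rw [hP x MeasurableSet.univ]
  have h1 : ∀ y : Fin n → Ω, (∑ j, ENNReal.ofReal (w (Fin.cons (α := fun _ : Fin (n + 1) => Ω) x y j)) *
      Set.univ.indicator (fun _ => (1 : ℝ≥0∞)) (Fin.cons (α := fun _ : Fin (n + 1) => Ω) x y j)) /
      (∑ i, ENNReal.ofReal (w (Fin.cons (α := fun _ : Fin (n + 1) => Ω) x y i))) = 1 := fun y => by
    simp only [Set.indicator_univ, mul_one]
    exact ENNReal.div_self (sum_weight_pos_ne_top hw0 _).1 (sum_weight_pos_ne_top hw0 _).2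
  simp_rw [h1]
  rw [lintegral_const, measure_univ, mul_one]

/-- **`π` IS INVARIANT FOR THE MULTI-PROPOSAL FLOW SAMPLER**: `∫ P(x, B) π(dx) = π(B)` for every measurable `B`. [ours] -/
theorem multiProposal_invariant (hw : Measurable w) (hw0 : ∀ y, 0 < w y) (P : Kernel Ω Ω)
    (hP : ∀ (x : Ω) {B : Set Ω}, MeasurableSet B → P x B = ∫⁻ y, (∑ j, ENNReal.ofReal (w (Fin.cons (α := fun _ : Fin (n + 1) => Ω) x y j)) *
      B.indicator (fun _ => (1 : ℝ≥0∞)) (Fin.cons (α := fun _ : Fin (n + 1) => Ω) x y j)) /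
      (∑ i, ENNReal.ofReal (w (Fin.cons (α := fun _ : Fin (n + 1) => Ω) x y i))) ∂(Measure.pi fun _ : Fin n => q))
    {B : Set Ω} (hB : MeasurableSet B) :
    ∫⁻ x, P x B ∂(q.withDensity fun x => ENNReal.ofReal (w x)) = (q.withDensity fun x => ENNReal.ofReal (w x)) B := by
  set π : Measure Ω := q.withDensity fun x => ENNReal.ofReal (w x) with hπ
  calc ∫⁻ x, P x B ∂π = ∫⁻ x in Set.univ, P x B ∂π := by rw [Measure.restrict_univ]
    _ = ∫⁻ x in B, P x Set.univ ∂π := multiProposal_detailedBalance hw P hP MeasurableSet.univ hB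
    _ = ∫⁻ x in B, 1 ∂π := by simp_rw [multiProposal_apply_univ hw0 P hP]
    _ = π B := by rw [setLIntegral_const, one_mul]

end Summit.Ventures.LatticeQCDFlow.Exactness
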